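import Mathlib
import Literature.Analysis.ODE.OneSidedLipschitzGronwall

/-!
# A Lyapunov certificate is an n-uniform one-sided Lipschitz bound for the Galerkin fields (instab g14, cell `ns-blowup`, 2026-08-26)

HONEST FRAMING (human ruling D-0035): nothing here is a claim about Navier–Stokes blow-up.
WHAT THIS IS NOT: not NS evidence. `BoundedGeneratorDuhamel` / `BoundedGeneratorEmergence`
(g14) discharge the analytic inputs (M) and (T) of the R-β chain for every BOUNDED generator, i.e.
at each Galerkin level. What separates that from the TRUE (unbounded) linearised operator is the
passage Galerkin → full system. The tree already holds an engine for this passage that needs NO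
semigroup theory: the Wilczak–Zgliczyński `C⁰`-convergence theorem
`Literature.Analysis.ODE.GalerkinConvergenceSetting.exists_limit` (`GalerkinLimit.lean`), whose
analytic hypothesis (C2) is «the Galerkin fields `y ↦ P_n F(y)` are ONE-SIDED LIPSCHITZ on
`P_n '' W` with one constant `l` UNIFORMLY in `n`». This file records, as kernel sentences, that a
3-L-type Lyapunov certificate for the linear part — read in the certificate's own inner product
(the phase space renormed by the weight `G`, in which the certificate is the plain inequality
`⟪A w, w⟫ ≤ ω ‖w‖²`) — together with a Lipschitz bound for the nonlinearity on the set `W` of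
self-consistent bounds, IS condition (C2), with `l = ω + K` and uniformly over every symmetric
idempotent truncation `P` mapping `W` into itself:

* `inner_sub_le_of_linear_add_lipschitz` — `⟪A w, w⟫ ≤ ω‖w‖²` for all `w` (`A` merely linear —
  no boundedness needed, so an operator defined on an algebraic core qualifies) and
  `‖N x − N y‖ ≤ K‖x − y‖` on `W` give the monotonicity inequality
  `⟪F x − F y, x − y⟫ ≤ (ω + K)‖x − y‖²` on `W` for `F = A + N`;
* `oneSidedLipschitzOnWith_of_linear_add_lipschitz` — hence `OneSidedLipschitzOnWith (ω + K) F W`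
  (tree supplier `oneSidedLipschitzOnWith_of_inner_le`, HNW §I.10 (10.20));
* `inner_galerkin_sub_eq`, `oneSidedLipschitzOnWith_galerkin` — for a symmetric idempotent `P`
  with `P '' W ⊆ W`, the truncated field `y ↦ P (F y)` satisfies the SAME monotonicity inequality on
  `P '' W` (`⟪P(Fx − Fy), x − y⟫ = ⟪Fx − Fy, x − y⟫` there), hence
  `OneSidedLipschitzOnWith l (P ∘ F) (P '' W)` with the same `l` — for a family `P n` this is
  literally the field `oneSided` of `GalerkinConvergenceSetting` with one `l` for all `n`
  (`galerkin_oneSided_uniform`);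
* `norm_bilinear_diag_sub_le`, `lipschitzOn_bilinear_diag_of_bounded` — the supplier of `K` for a
  quadratic nonlinearity `N x = B x x` with `‖B x y‖ ≤ c‖x‖‖y‖` on a set inside the ball of
  radius `R`: `K = 2cR`.

So the Galerkin → true passage for the R-β / KILL sentences reduces to: (i) the G-renorming
(type-synonym bookkeeping), (ii) a compact Galerkin-invariant `W` with decaying tails on which the
convective term is Lipschitz in the certificate norm (`GalerkinCompactness.lean`; model-specific,
the `c_alg`-type lattice bounds of `ConvectiveProductLawLattice`), (iii) `exists_limit`. Nothing here
is about singularity formation. Mathlib + `Literature.Analysis.ODE.OneSidedLipschitzGronwall`;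
no new definitions.
-/

noncomputable section

namespace Summit.NavierStokesRegularity.FluidComputer.GalerkinOneSidedLipschitz

open Set Filter Topology
open scoped InnerProductSpace
open Literature.Analysis.ODE

variable {F : Type*} [NormedAddCommGroup F] [InnerProductSpace ℝ F]

/-! ### The certificate as a monotonicity inequality -/

/-- **Linear certificate + Lipschitz nonlinearity ⇒ monotonicity inequality.** If a linear map
`A` (not necessarily bounded) satisfies the Lyapunov inequality `⟪A w, w⟫ ≤ ω ‖w‖²` for every
`w`, and `N` is `K`-Lipschitz on `W`, then `F = A + N` satisfies
`⟪F x − F y, x − y⟫ ≤ (ω + K) ‖x − y‖²` for all `x, y ∈ W`. -/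
theorem inner_sub_le_of_linear_add_lipschitz (A : F →ₗ[ℝ] F) (N : F → F) {W : Set F} {ω K : ℝ}
    (hA : ∀ w : F, ⟪A w, w⟫_ℝ ≤ ω * ‖w‖ ^ 2)
    (hN : ∀ x ∈ W, ∀ y ∈ W, ‖N x - N y‖ ≤ K * ‖x - y‖) :
    ∀ x ∈ W, ∀ y ∈ W,
      ⟪(A x + N x) - (A y + N y), x - y⟫_ℝ ≤ (ω + K) * ‖x - y‖ ^ 2 := by
  intro x hx y hy
  have hsplit : (A x + N x) - (A y + N y) = A (x - y) + (N x - N y) := by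
    rw [map_sub]; abel
  rw [hsplit, inner_add_left]
  have h1 : ⟪A (x - y), x - y⟫_ℝ ≤ ω * ‖x - y‖ ^ 2 := hA (x - y)
  have h2 : ⟪N x - N y, x - y⟫_ℝ ≤ K * ‖x - y‖ ^ 2 := by
    calc ⟪N x - N y, x - y⟫_ℝ ≤ ‖N x - N y‖ * ‖x - y‖ := real_inner_le_norm _ _
      _ ≤ K * ‖x - y‖ * ‖x - y‖ := mul_le_mul_of_nonneg_right (hN x hx y hy) (norm_nonneg _)
      _ = K * ‖x - y‖ ^ 2 := by ring
  calc ⟪A (x - y), x - y⟫_ℝ + ⟪N x - N y, x - y⟫_ℝ ≤ ω * ‖x - y‖ ^ 2 + K * ‖x - y‖ ^ 2 :=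
        add_le_add h1 h2
    _ = (ω + K) * ‖x - y‖ ^ 2 := by ring

/-- **Hence a one-sided Lipschitz bound** (HNW §I.10 Thm. 10.5 (10.20), tree supplier
`oneSidedLipschitzOnWith_of_inner_le`): `OneSidedLipschitzOnWith (ω + K) (A + N) W`. -/
theorem oneSidedLipschitzOnWith_of_linear_add_lipschitz (A : F →ₗ[ℝ] F) (N : F → F) {W : Set F}
    {ω K : ℝ} (hA : ∀ w : F, ⟪A w, w⟫_ℝ ≤ ω * ‖w‖ ^ 2)
    (hN : ∀ x ∈ W, ∀ y ∈ W, ‖N x - N y‖ ≤ K * ‖x - y‖) :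
    OneSidedLipschitzOnWith (ω + K) (fun y => A y + N y) W :=
  oneSidedLipschitzOnWith_of_inner_le (inner_sub_le_of_linear_add_lipschitz A N hA hN)

/-! ### Truncation preserves the bound, uniformly -/

/-- **The truncated field has the same form on the range of the truncation.** For a symmetric
`P` (`⟪P a, b⟫ = ⟪a, P b⟫`) and points fixed by `P` (`P x = x`, `P y = y`):
`⟪P u, x − y⟫ = ⟪u, x − y⟫` for every `u` — in particular for `u = F x − F y`. -/
theorem inner_galerkin_sub_eq {P : F →L[ℝ] F} (hPsymm : ∀ a b : F, ⟪P a, b⟫_ℝ = ⟪a, P b⟫_ℝ)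
    {x y : F} (hx : P x = x) (hy : P y = y) (u : F) :
    ⟪P u, x - y⟫_ℝ = ⟪u, x - y⟫_ℝ := by
  rw [hPsymm, map_sub, hx, hy]

/-- **Galerkin truncation preserves the one-sided Lipschitz constant.** Let `P` be symmetric and
idempotent with `P '' W ⊆ W` (the setting's `mapsTo`), and let `F` satisfy the monotonicity
inequality `⟪F x − F y, x − y⟫ ≤ l ‖x − y‖²` on `W`. Then the truncated field `y ↦ P (F y)`
satisfies `OneSidedLipschitzOnWith l (P ∘ F) (P '' W)` with the SAME `l`. -/
theorem oneSidedLipschitzOnWith_galerkin {P : F →L[ℝ] F}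
    (hPsymm : ∀ a b : F, ⟪P a, b⟫_ℝ = ⟪a, P b⟫_ℝ) (hPidem : ∀ w : F, P (P w) = P w)
    {W : Set F} (hPW : MapsTo P W W) {F' : F → F} {l : ℝ}
    (hF : ∀ x ∈ W, ∀ y ∈ W, ⟪F' x - F' y, x - y⟫_ℝ ≤ l * ‖x - y‖ ^ 2) :
    OneSidedLipschitzOnWith l (fun y => P (F' y)) (P '' W) := by
  refine oneSidedLipschitzOnWith_of_inner_le ?_
  rintro x ⟨a, ha, rfl⟩ y ⟨b, hb, rfl⟩
  have hx : P (P a) = P a := hPidem a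
  have hy : P (P b) = P b := hPidem b
  rw [← map_sub, inner_galerkin_sub_eq hPsymm hx hy]
  exact hF (P a) (hPW ha) (P b) (hPW hb)

/-- **Condition (C2) of `GalerkinConvergenceSetting`, uniformly in the level.** For a family of
symmetric idempotent truncations `P n` each mapping `W` into `W`, a linear part with the Lyapunov
certificate `⟪A w, w⟫ ≤ ω‖w‖²` and a nonlinearity `K`-Lipschitz on `W`: for EVERY `n`,
`OneSidedLipschitzOnWith (ω + K) (fun y => P n (A y + N y)) (P n '' W)` — one constant
`l = ω + K` for all levels (literally the field `oneSided` of
`Literature.Analysis.ODE.GalerkinConvergenceSetting` for the field `A + N`). -/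
theorem galerkin_oneSided_uniform (P : ℕ → F →L[ℝ] F)
    (hPsymm : ∀ n, ∀ a b : F, ⟪P n a, b⟫_ℝ = ⟪a, P n b⟫_ℝ) (hPidem : ∀ n, ∀ w : F, P n (P n w) = P n w)
    {W : Set F} (hPW : ∀ n, MapsTo (P n) W W) (A : F →ₗ[ℝ] F) (N : F → F) {ω K : ℝ}
    (hA : ∀ w : F, ⟪A w, w⟫_ℝ ≤ ω * ‖w‖ ^ 2)
    (hN : ∀ x ∈ W, ∀ y ∈ W, ‖N x - N y‖ ≤ K * ‖x - y‖) :
    ∀ n, OneSidedLipschitzOnWith (ω + K) (fun y => P n (A y + N y)) (P n '' W) :=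
  fun n => oneSidedLipschitzOnWith_galerkin (hPsymm n) (hPidem n) (hPW n)
    (F' := fun y => A y + N y) (inner_sub_le_of_linear_add_lipschitz A N hA hN)

/-! ### The supplier of `K` for a quadratic nonlinearity on a bounded set -/

omit [InnerProductSpace ℝ F] in
/-- **Difference of a quadratic nonlinearity.** For a bilinear `B` with `‖B x y‖ ≤ c‖x‖‖y‖`:
`‖B x x − B y y‖ ≤ c (‖x‖ + ‖y‖) ‖x − y‖` (`B x x − B y y = B (x − y) x + B y (x − y)`). -/
theorem norm_bilinear_diag_sub_le [NormedSpace ℝ F] (B : F →ₗ[ℝ] F →ₗ[ℝ] F) {c : ℝ}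
    (hB : ∀ x y : F, ‖B x y‖ ≤ c * ‖x‖ * ‖y‖) (x y : F) :
    ‖B x x - B y y‖ ≤ c * (‖x‖ + ‖y‖) * ‖x - y‖ := by
  have hsplit : B x x - B y y = B (x - y) x + B y (x - y) := by
    rw [map_sub, LinearMap.sub_apply, map_sub]; abel
  rw [hsplit]
  calc ‖B (x - y) x + B y (x - y)‖ ≤ ‖B (x - y) x‖ + ‖B y (x - y)‖ := norm_add_le _ _
    _ ≤ c * ‖x - y‖ * ‖x‖ + c * ‖y‖ * ‖x - y‖ := add_le_add (hB _ _) (hB _ _)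
    _ = c * (‖x‖ + ‖y‖) * ‖x - y‖ := by ring

omit [InnerProductSpace ℝ F] in
/-- **Lipschitz constant of `x ↦ B x x` on a bounded set:** if `W` lies in the closed ball of radius
`R` and `‖B x y‖ ≤ c‖x‖‖y‖` with `c ≥ 0`, then `‖B x x − B y y‖ ≤ 2cR ‖x − y‖` on `W` — the
hypothesis `hN` of `galerkin_oneSided_uniform` with `K = 2cR`. -/
theorem lipschitzOn_bilinear_diag_of_bounded [NormedSpace ℝ F] (B : F →ₗ[ℝ] F →ₗ[ℝ] F) {c R : ℝ}
    (hc : 0 ≤ c) (hB : ∀ x y : F, ‖B x y‖ ≤ c * ‖x‖ * ‖y‖) {W : Set F} (hW : ∀ x ∈ W, ‖x‖ ≤ R) :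
    ∀ x ∈ W, ∀ y ∈ W, ‖B x x - B y y‖ ≤ 2 * c * R * ‖x - y‖ := by
  intro x hx y hy
  have h := norm_bilinear_diag_sub_le B hB x y
  have hsum : ‖x‖ + ‖y‖ ≤ 2 * R := by linarith [hW x hx, hW y hy]
  have hxy : 0 ≤ ‖x - y‖ := norm_nonneg _
  calc ‖B x x - B y y‖ ≤ c * (‖x‖ + ‖y‖) * ‖x - y‖ := h
    _ ≤ c * (2 * R) * ‖x - y‖ :=
        mul_le_mul_of_nonneg_right (mul_le_mul_of_nonneg_left hsum hc) hxy
    _ = 2 * c * R * ‖x - y‖ := by ring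

/-! ### Appendix (instab g15, 2026-08-26): condition (C2) for a derivative-losing quadratic term — first-slot bound + transport bound

For the Navier–Stokes bilinearity `B (x, y) = ℙ[(x·∇)y]` the map `x ↦ B (x, x)` is NOT Lipschitz
on a bounded set in any single Sobolev norm (the difference `B y (x − y)` carries a derivative of
`x − y`), so `lipschitzOn_bilinear_diag_of_bounded` does not apply; what holds instead, on a set
`W` of self-consistent bounds, is a FIRST-SLOT bound `‖B (x − y, x)‖ ≤ c₁ ‖x − y‖` (the strong size
of the target `x ∈ W` absorbed into `c₁`) and a one-sided TRANSPORT bound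
`⟪B (y, x − y), x − y⟫ ≤ κ ‖x − y‖²` (energy/commutator structure of advection by `y ∈ W`) — the
shape of [WilczakZgliczynski2025, §7] conditions C/VC for NS-type fields (`p = 2 > r = 1`).
These two bounds give the monotonicity inequality directly, hence (C2) uniformly in the
truncation level by `oneSidedLipschitzOnWith_galerkin`, with ANY linear-part constant `ω`
(the sign of `l = ω + c₁ + κ` is irrelevant for the `C⁰`-convergence theorem; the certified
Lyapunov constants enter only the emergence/decay bounds, `GalerkinEmergenceCertificate`).
`A` and `B` are arbitrary functions here: only their values on `W` and on differences of
elements of `W` enter, so unbounded operators with junk values elsewhere qualify. -/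

/-- **Monotonicity inequality for a quadratic term from a first-slot bound and a transport
bound.** If on `W` the quadratic term splits as `B x x − B y y = B (x − y) x + B y (x − y)`
(bilinearity), the first slot is bounded against targets in `W`, `‖B (x − y) x‖ ≤ c₁ ‖x − y‖`, and
advection by elements of `W` is one-sided, `⟪B y (x − y), x − y⟫ ≤ κ ‖x − y‖²`, then
`⟪B x x − B y y, x − y⟫ ≤ (c₁ + κ) ‖x − y‖²` on `W`. -/
theorem inner_quadratic_sub_le {B : F → F → F} {W : Set F} {c₁ κ : ℝ}
    (hsplit : ∀ x ∈ W, ∀ y ∈ W, B x x - B y y = B (x - y) x + B y (x - y))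
    (hfirst : ∀ x ∈ W, ∀ y ∈ W, ‖B (x - y) x‖ ≤ c₁ * ‖x - y‖)
    (htransport : ∀ x ∈ W, ∀ y ∈ W, ⟪B y (x - y), x - y⟫_ℝ ≤ κ * ‖x - y‖ ^ 2) :
    ∀ x ∈ W, ∀ y ∈ W, ⟪B x x - B y y, x - y⟫_ℝ ≤ (c₁ + κ) * ‖x - y‖ ^ 2 := by
  intro x hx y hy
  rw [hsplit x hx y hy, inner_add_left]
  have h1 : ⟪B (x - y) x, x - y⟫_ℝ ≤ c₁ * ‖x - y‖ ^ 2 :=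
    calc ⟪B (x - y) x, x - y⟫_ℝ ≤ ‖B (x - y) x‖ * ‖x - y‖ := real_inner_le_norm _ _
      _ ≤ c₁ * ‖x - y‖ * ‖x - y‖ :=
          mul_le_mul_of_nonneg_right (hfirst x hx y hy) (norm_nonneg _)
      _ = c₁ * ‖x - y‖ ^ 2 := by ring
  have h2 := htransport x hx y hy
  calc ⟪B (x - y) x, x - y⟫_ℝ + ⟪B y (x - y), x - y⟫_ℝ ≤ c₁ * ‖x - y‖ ^ 2 + κ * ‖x - y‖ ^ 2 :=
        add_le_add h1 h2
    _ = (c₁ + κ) * ‖x - y‖ ^ 2 := by ring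

/-- **Monotonicity inequality for `A + B(·,·)` on `W`:** a one-sided bound for the linear part on
differences of elements of `W`, `⟪A x − A y, x − y⟫ ≤ ω ‖x − y‖²` (ANY `ω`), plus the two bounds of
`inner_quadratic_sub_le`, give `⟪F x − F y, x − y⟫ ≤ (ω + c₁ + κ) ‖x − y‖²` for
`F = A + B(·,·)` on `W`. -/
theorem inner_sub_le_of_linear_add_transport {A : F → F} {B : F → F → F} {W : Set F}
    {ω c₁ κ : ℝ} (hA : ∀ x ∈ W, ∀ y ∈ W, ⟪A x - A y, x - y⟫_ℝ ≤ ω * ‖x - y‖ ^ 2)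
    (hsplit : ∀ x ∈ W, ∀ y ∈ W, B x x - B y y = B (x - y) x + B y (x - y))
    (hfirst : ∀ x ∈ W, ∀ y ∈ W, ‖B (x - y) x‖ ≤ c₁ * ‖x - y‖)
    (htransport : ∀ x ∈ W, ∀ y ∈ W, ⟪B y (x - y), x - y⟫_ℝ ≤ κ * ‖x - y‖ ^ 2) :
    ∀ x ∈ W, ∀ y ∈ W,
      ⟪(A x + B x x) - (A y + B y y), x - y⟫_ℝ ≤ (ω + c₁ + κ) * ‖x - y‖ ^ 2 := by
  intro x hx y hy
  have hs : (A x + B x x) - (A y + B y y) = (A x - A y) + (B x x - B y y) := by abel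
  rw [hs, inner_add_left]
  have h1 := hA x hx y hy
  have h2 := inner_quadratic_sub_le hsplit hfirst htransport x hx y hy
  calc ⟪A x - A y, x - y⟫_ℝ + ⟪B x x - B y y, x - y⟫_ℝ
      ≤ ω * ‖x - y‖ ^ 2 + (c₁ + κ) * ‖x - y‖ ^ 2 := add_le_add h1 h2
    _ = (ω + c₁ + κ) * ‖x - y‖ ^ 2 := by ring

/-- **Condition (C2) of `GalerkinConvergenceSetting` for a derivative-losing quadratic field,
uniformly in the level.** For symmetric idempotent truncations `P n` mapping `W` into `W` and a
field `F = A + B(·,·)` with the three bounds of `inner_sub_le_of_linear_add_transport` on `W`: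
for EVERY `n`, `OneSidedLipschitzOnWith (ω + c₁ + κ) (fun y => P n (A y + B y y)) (P n '' W)` —
one constant for all levels (field `oneSided` of
`Literature.Analysis.ODE.GalerkinConvergenceSetting`). -/
theorem galerkin_oneSided_uniform_transport (P : ℕ → F →L[ℝ] F)
    (hPsymm : ∀ n, ∀ a b : F, ⟪P n a, b⟫_ℝ = ⟪a, P n b⟫_ℝ) (hPidem : ∀ n, ∀ w : F, P n (P n w) = P n w)
    {W : Set F} (hPW : ∀ n, MapsTo (P n) W W) {A : F → F} {B : F → F → F} {ω c₁ κ : ℝ}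
    (hA : ∀ x ∈ W, ∀ y ∈ W, ⟪A x - A y, x - y⟫_ℝ ≤ ω * ‖x - y‖ ^ 2)
    (hsplit : ∀ x ∈ W, ∀ y ∈ W, B x x - B y y = B (x - y) x + B y (x - y))
    (hfirst : ∀ x ∈ W, ∀ y ∈ W, ‖B (x - y) x‖ ≤ c₁ * ‖x - y‖)
    (htransport : ∀ x ∈ W, ∀ y ∈ W, ⟪B y (x - y), x - y⟫_ℝ ≤ κ * ‖x - y‖ ^ 2) :
    ∀ n, OneSidedLipschitzOnWith (ω + c₁ + κ) (fun y => P n (A y + B y y)) (P n '' W) :=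
  fun n => oneSidedLipschitzOnWith_galerkin (hPsymm n) (hPidem n) (hPW n)
    (F' := fun y => A y + B y y) (inner_sub_le_of_linear_add_transport hA hsplit hfirst htransport)

/-! ### Appendix 2 (instab g16, 2026-08-27): condition (C2) needs the three bounds only on the TRUNCATED elements of `W`

Condition (C2) of `GalerkinConvergenceSetting` (`oneSided`) speaks about the sets `P n '' W` only.
For NESTED truncations (`P n ∘ P k = P k ∘ P n = P (min n k)`, written as the two one-sided
identities below — the second follows from the first for symmetric `P`, but both are kept explicit)
the union `⋃ n, P n '' W` of all truncated elements of `W` is itself invariant under every `P n`,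
and `P n '' W ⊆ P n '' (⋃ k, P k '' W)`. So it suffices to verify `hA`, `hfirst`, `htransport` on
pairs of FINITELY TRUNCATED elements of `W` — on the lattice these are finitely supported
coefficient families, for which the transport estimates of `TransportCommutatorLattice` /
`TransportSkewLattice` hold with their rapidly-decreasing hypotheses satisfied trivially, and with
constants controlled by the polynomial box uniformly in the level. -/

/-- The union of the truncated images of `W` is invariant under every truncation, for nested
truncations. -/
theorem mapsTo_iUnion_image_of_nested (P : ℕ → F →L[ℝ] F)
    (hle : ∀ n k, n ≤ k → ∀ w, P n (P k w) = P n w) (hge : ∀ n k, n ≤ k → ∀ w, P k (P n w) = P n w)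
    (W : Set F) (n : ℕ) : MapsTo (P n) (⋃ k, P k '' W) (⋃ k, P k '' W) := by
  intro x hx
  obtain ⟨k, hk⟩ := mem_iUnion.1 hx
  obtain ⟨w, hw, rfl⟩ := hk
  rcases le_total n k with h | h
  · exact mem_iUnion.2 ⟨n, ⟨w, hw, (hle n k h w).symm⟩⟩
  · exact mem_iUnion.2 ⟨k, ⟨w, hw, (hge k n h w).symm⟩⟩

/-- `P n '' W ⊆ P n '' (⋃ k, P k '' W)` for idempotent `P n`. -/
theorem image_subset_image_iUnion (P : ℕ → F →L[ℝ] F) (hPidem : ∀ n, ∀ w : F, P n (P n w) = P n w)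
    (W : Set F) (n : ℕ) : P n '' W ⊆ P n '' (⋃ k, P k '' W) := by
  rintro x ⟨w, hw, rfl⟩
  exact ⟨P n w, mem_iUnion.2 ⟨n, ⟨w, hw, rfl⟩⟩, hPidem n w⟩

/-- **Condition (C2), uniformly in the level, from the three bounds on TRUNCATED elements only.**
For symmetric idempotent NESTED truncations `P n` mapping `W` into `W` and a field `F = A + B(·,·)`
whose one-sided linear bound, first-slot bound and transport bound hold on the finitely truncated
elements `⋃ k, P k '' W` of `W` (rather than on all of `W`): for every `n`,
`OneSidedLipschitzOnWith (ω + c₁ + κ) (fun y => P n (A y + B y y)) (P n '' W)`. -/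
theorem galerkin_oneSided_uniform_transport_of_truncated (P : ℕ → F →L[ℝ] F)
    (hPsymm : ∀ n, ∀ a b : F, ⟪P n a, b⟫_ℝ = ⟪a, P n b⟫_ℝ) (hPidem : ∀ n, ∀ w : F, P n (P n w) = P n w)
    (hle : ∀ n k, n ≤ k → ∀ w, P n (P k w) = P n w) (hge : ∀ n k, n ≤ k → ∀ w, P k (P n w) = P n w)
    {W : Set F} {A : F → F} {B : F → F → F} {ω c₁ κ : ℝ}
    (hA : ∀ x ∈ ⋃ k, P k '' W, ∀ y ∈ ⋃ k, P k '' W, ⟪A x - A y, x - y⟫_ℝ ≤ ω * ‖x - y‖ ^ 2)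
    (hsplit : ∀ x ∈ ⋃ k, P k '' W, ∀ y ∈ ⋃ k, P k '' W, B x x - B y y = B (x - y) x + B y (x - y))
    (hfirst : ∀ x ∈ ⋃ k, P k '' W, ∀ y ∈ ⋃ k, P k '' W, ‖B (x - y) x‖ ≤ c₁ * ‖x - y‖)
    (htransport : ∀ x ∈ ⋃ k, P k '' W, ∀ y ∈ ⋃ k, P k '' W,
      ⟪B y (x - y), x - y⟫_ℝ ≤ κ * ‖x - y‖ ^ 2) :
    ∀ n, OneSidedLipschitzOnWith (ω + c₁ + κ) (fun y => P n (A y + B y y)) (P n '' W) :=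
  fun n => (galerkin_oneSided_uniform_transport P hPsymm hPidem
    (mapsTo_iUnion_image_of_nested P hle hge W) hA hsplit hfirst htransport n).mono
      (image_subset_image_iUnion P hPidem W n)

/-- For SYMMETRIC truncations the second nesting identity follows from the first:
`P n ∘ P k = P n` for `n ≤ k` implies `P k ∘ P n = P n` (take adjoints). -/
theorem nested_ge_of_le_of_symm (P : ℕ → F →L[ℝ] F)
    (hPsymm : ∀ n, ∀ a b : F, ⟪P n a, b⟫_ℝ = ⟪a, P n b⟫_ℝ)
    (hle : ∀ n k, n ≤ k → ∀ w, P n (P k w) = P n w) :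
    ∀ n k, n ≤ k → ∀ w, P k (P n w) = P n w := by
  intro n k h w
  refine ext_inner_right ℝ fun z => ?_
  rw [hPsymm k, hPsymm n, hPsymm n w z, hle n k h z]

end Summit.NavierStokesRegularity.FluidComputer.GalerkinOneSidedLipschitz

end
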